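import Literature.MathematicalPhysics.QuantumManyBody.SwapPurity
import Summits.AtomisticToContinuum.BoseEinsteinCondensation.Statement

/-!
# The residue criterion: BEC from a non-vanishing one-particle residue

Conjunct `BoseEinsteinCondensation` of `AtomisticToContinuum`. Write `Z = x :: X̂ ∈ (ℝ³)^{n+1}`,
`N = n + 1`. For a one-particle mode `φ` and ANY sub-normalised `n`-particle amplitude `Θ`
(`∫ |Θ|² ≤ 1`) the pairing

  `A_{φ,Θ}(Ψ) = ∫ (∫ conj φ(x) Ψ(x, X̂) dx) conj Θ(X̂) dX̂ = ⟨φ ⊗ Θ, Ψ⟩`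

is the amplitude for removing one particle from `Ψ` in the mode `φ` and landing on `Θ`
(`A = ⟨Θ, a(φ) Ψ⟩ / √N`). Cauchy–Schwarz in the variable `X̂` gives, for every `Ψ`,

  `⟨φ, γ_Ψ φ⟩ = N ∫ |∫ conj φ(x) Ψ(x, X̂) dx|² dX̂ ≥ N |A_{φ,Θ}(Ψ)|²`     (`SoloInformed.sq_pairing_le_occupation`)

with equality iff `Θ ∝ a(φ)Ψ`; so `⟨φ, γ_Ψ φ⟩ = N sup_Θ |A_{φ,Θ}(Ψ)|²`. Consequently
(`SoloInformed.hasGroundStateBEC_of_pairing`): if there are normalised modes `φ_N` and sub-normalised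
amplitudes `Θ_{N-1}` with `|⟨φ_N ⊗ Θ_{N-1}, Ψ⟩|² ≥ c` for every near-minimiser `Ψ` of `H_N` in
`Λ_{L_N}`, uniformly in `N`, then `HasGroundStateBEC v ρ` (with the same constant `c`).

Reading. With `φ_N` the zero-momentum (flat) mode and `Θ_{N-1} = Ψ₀^{(N-1)}` the ground state of
`N - 1` particles in the same box, `Z_N = ⟨φ_N ⊗ Ψ₀^{(N-1)}, Ψ₀^{(N)}⟩` is the *one-particle
(quasiparticle) residue at zero momentum*: the overlap of the `N`-particle ground state with the
state obtained by adding one condensate particle to the `(N-1)`-particle ground state. The criterion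
says `N₀ ≥ N Z_N²`: **ground-state BEC follows from the absence of a bosonic orthogonality catastrophe
for the gas's own added particle**, `inf_N Z_N > 0`. Bogoliubov theory predicts `Z_N² → n₀ = N₀/N`
(the criterion is then sharp), whereas for an impurity in an *ideal* Bose gas `Z_N → 0`
(the bosonic orthogonality catastrophe, arXiv:2004.07166, eq. (3)); in the interacting gas the phonon
stiffness is what is expected to keep `Z_N` positive (ibid., eq. (14)). Since `H_N = H_{N-1} ⊗ 1 +
(-Δ_{x₁}) + W`, `W = ∑_{j ≥ 2} v(x₁ - x_j) ≥ 0`, the residue against the Dirichlet mode `φ_D`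
satisfies the exact identities `Z'_N (E₀(N) - E₀(N-1) - E_D) = ⟨φ_D ⊗ Ψ₀^{(N-1)}, W Ψ₀^{(N)}⟩` and
`-2 log Z'_N = ∫₀^∞ (ε(s) - ε(∞)) ds` with `ε(s)` the (monotonically relaxing) excess energy along the
imaginary-time evolution started from `φ_D ⊗ Ψ₀^{(N-1)}`; a proof of the conjunct along this door must
show that this relaxation integral is bounded uniformly in the volume — an infrared statement on the
same footing as the entropic criterion of the accompanying report (`paper/sharpest.md`, §4). The
inequality itself is [folklore] (Cauchy–Schwarz); the door and its reading are the content.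
[cite: LSSY2005, §1.2 (1.17)–(1.19); PenroseOnsager1956, §4]
-/

noncomputable section

open MeasureTheory Filter Set
open scoped ENNReal NNReal ComplexConjugate

namespace Summit.AtomisticToContinuum.BoseEinsteinCondensation.Theorems

open Literature.MathematicalPhysics.QuantumManyBody.BoseGas

variable {n : ℕ}

/-- `X̂ ↦ ∫ conj φ(x) Ψ(x :: X̂) dx` (the `φ`-component of the slice `Ψ(·, X̂)`) is measurable for
measurable `φ`, `Ψ`. [folklore] -/
theorem SoloInformed.measurable_modePairing {φ : Space → ℂ} (hφ : Measurable φ)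
    {Ψ : Config (n + 1) → ℂ} (hΨ : Measurable Ψ) :
    Measurable fun Y : Config n => ∫ x, conj (φ x) * Ψ (Matrix.vecCons x Y) := by
  have hG : Measurable fun q : Config n × Space => conj (φ q.2) * Ψ (Matrix.vecCons q.2 q.1) :=
    (Complex.continuous_conj.measurable.comp (hφ.comp measurable_snd)).mul
      (hΨ.comp (measurable_vecCons.comp (measurable_snd.prodMk measurable_fst)))
  exact (hG.stronglyMeasurable.integral_prod_right' (ν := (volume : Measure Space))).measurable

/-- **Residue inequality** (Cauchy–Schwarz in `X̂`): for every mode `φ`, every wave function `Ψ` of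
`N = n + 1` particles and every sub-normalised `n`-particle amplitude `Θ`,
`N |⟨φ ⊗ Θ, Ψ⟩|² = N |∫ (∫ conj φ(x) Ψ(x, X̂) dx) conj Θ(X̂) dX̂|² ≤ ⟨φ, γ_Ψ φ⟩`.
(Equality for `Θ ∝ a(φ)Ψ`; the Bochner integral is `0`, and the bound trivial, when the pairing is
not integrable.) [folklore] -/
theorem SoloInformed.sq_pairing_le_occupation {φ : Space → ℂ} (hφ : Measurable φ)
    {Ψ : Config (n + 1) → ℂ} (hΨ : Measurable Ψ) {Θ : Config n → ℂ}
    (hΘ : AEStronglyMeasurable Θ volume) (hΘ1 : ∫⁻ Y, (‖Θ Y‖₊ : ℝ≥0∞) ^ 2 ≤ 1) :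
    (n + 1 : ℝ≥0∞) *
        (‖∫ Y, (∫ x, conj (φ x) * Ψ (Matrix.vecCons x Y)) * conj (Θ Y)‖₊ : ℝ≥0∞) ^ 2 ≤
      occupation (n + 1) φ Ψ := by
  rw [occupation]
  gcongr
  calc (‖∫ Y, (∫ x, conj (φ x) * Ψ (Matrix.vecCons x Y)) * conj (Θ Y)‖₊ : ℝ≥0∞) ^ 2
      ≤ (∫⁻ Y, (‖∫ x, conj (φ x) * Ψ (Matrix.vecCons x Y)‖₊ : ℝ≥0∞) ^ 2) *
          ∫⁻ Y, (‖Θ Y‖₊ : ℝ≥0∞) ^ 2 :=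
        sq_nnnorm_integral_mul_conj_le (SoloInformed.measurable_modePairing hφ hΨ).aemeasurable
          hΘ.aemeasurable
    _ ≤ (∫⁻ Y, (‖∫ x, conj (φ x) * Ψ (Matrix.vecCons x Y)‖₊ : ℝ≥0∞) ^ 2) * 1 := by gcongr
    _ = _ := mul_one _

/-- **BEC from a non-vanishing residue.** Let `φ_n` be normalised measurable one-particle modes and
`Θ_n` sub-normalised `n`-particle amplitudes. If for all large `n` there is a slack `δ > 0` such that
every trial state `Ψ` of `N = n + 1` bosons in `Λ_{L_N}`, `L_N = (N/ρ)^{1/3}`, with energy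
`≤ E₀ + δ` has `|⟨φ_n ⊗ Θ_n, Ψ⟩|² ≥ c`, then the gas condenses in the ground state at density `ρ`,
with `λ_max(γ) ≥ c N`. With `φ_n` the flat mode and `Θ_n` the `n`-particle ground state this is
"BEC from the absence of an orthogonality catastrophe for the added particle"; the quasiparticle
residue `Z_N²` is predicted to equal the condensate fraction (Bogoliubov), so nothing is lost.
[cite: LSSY2005, §1.2 (1.17)–(1.19)] -/
theorem SoloInformed.hasGroundStateBEC_of_pairing (v : ℝ → ℝ≥0∞) (ρ : ℝ) {c : ℝ} (hc : 0 < c)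
    (φ : ℕ → Space → ℂ) (hφ : ∀ n, Measurable (φ n) ∧ ∫⁻ x, (‖φ n x‖₊ : ℝ≥0∞) ^ 2 = 1)
    (Θ : (n : ℕ) → Config n → ℂ)
    (hΘ : ∀ n, AEStronglyMeasurable (Θ n) volume ∧ ∫⁻ Y, (‖Θ n Y‖₊ : ℝ≥0∞) ^ 2 ≤ 1)
    (h : ∀ᶠ n : ℕ in atTop, ∃ δ : ℝ≥0∞, 0 < δ ∧
      ∀ Ψ : TrialState (n + 1) (sideLength ρ (n + 1)),
        energy v Ψ ≤ groundStateEnergy v (n + 1) (sideLength ρ (n + 1)) + δ →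
          ENNReal.ofReal c ≤
            (‖∫ Y, (∫ x, conj (φ n x) * Ψ.ψ (Matrix.vecCons x Y)) * conj (Θ n Y)‖₊ : ℝ≥0∞) ^ 2) :
    HasGroundStateBEC v ρ := by
  refine ⟨c, hc, ?_⟩
  obtain ⟨n₀, hn₀⟩ := Filter.eventually_atTop.1 h
  refine Filter.eventually_atTop.2 ⟨n₀ + 1, fun N hN => ?_⟩
  obtain ⟨n, rfl⟩ : ∃ n, N = n + 1 := ⟨N - 1, by omega⟩
  obtain ⟨δ, hδ, hδΨ⟩ := hn₀ n (by omega)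
  refine le_condensateNumber v hδ fun Ψ hΨ => ?_
  have hmeas : Measurable Ψ.ψ := Ψ.contDiff.continuous.measurable
  calc ENNReal.ofReal (c * ((n + 1 : ℕ) : ℝ))
      = (n + 1 : ℝ≥0∞) * ENNReal.ofReal c := by
        rw [mul_comm, ENNReal.ofReal_mul (by positivity), ENNReal.ofReal_natCast]
        push_cast
        ring
    _ ≤ (n + 1 : ℝ≥0∞) *
          (‖∫ Y, (∫ x, conj (φ n x) * Ψ.ψ (Matrix.vecCons x Y)) * conj (Θ n Y)‖₊ : ℝ≥0∞) ^ 2 := by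
        gcongr
        exact hδΨ Ψ hΨ
    _ ≤ occupation (n + 1) (φ n) Ψ.ψ :=
        SoloInformed.sq_pairing_le_occupation (hφ n).1 hmeas (hΘ n).1 (hΘ n).2
    _ ≤ maxOccupation (n + 1) Ψ.ψ :=
        occupation_le_maxOccupation Ψ.ψ (hφ n).1.aestronglyMeasurable (hφ n).2

/-- **The conjunct from residues.** If for every admissible `v` there is `ρ₀ > 0` such that at each
density `ρ ∈ (0, ρ₀)` some normalised modes `φ_n`, sub-normalised amplitudes `Θ_n` and a constant
`c > 0` satisfy the uniform residue bound of `SoloInformed.hasGroundStateBEC_of_pairing`, then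
`BoseEinsteinCondensation` holds. [cite: LSSY2005, §1.2 (1.19)] -/
theorem SoloInformed.boseEinsteinCondensation_of_pairing
    (H : ∀ v : ℝ → ℝ≥0∞, IsRepulsiveFiniteRange v → ∃ ρ₀ : ℝ, 0 < ρ₀ ∧ ∀ ρ : ℝ, 0 < ρ → ρ < ρ₀ →
      ∃ (c : ℝ) (φ : ℕ → Space → ℂ) (Θ : (n : ℕ) → Config n → ℂ), 0 < c ∧
        (∀ n, Measurable (φ n) ∧ ∫⁻ x, (‖φ n x‖₊ : ℝ≥0∞) ^ 2 = 1) ∧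
        (∀ n, AEStronglyMeasurable (Θ n) volume ∧ ∫⁻ Y, (‖Θ n Y‖₊ : ℝ≥0∞) ^ 2 ≤ 1) ∧
        ∀ᶠ n : ℕ in atTop, ∃ δ : ℝ≥0∞, 0 < δ ∧
          ∀ Ψ : TrialState (n + 1) (sideLength ρ (n + 1)),
            energy v Ψ ≤ groundStateEnergy v (n + 1) (sideLength ρ (n + 1)) + δ →
              ENNReal.ofReal c ≤
                (‖∫ Y, (∫ x, conj (φ n x) * Ψ.ψ (Matrix.vecCons x Y)) * conj (Θ n Y)‖₊ :
                  ℝ≥0∞) ^ 2) :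
    _root_.BoseEinsteinCondensation := by
  intro v hv
  obtain ⟨ρ₀, hρ₀, hρ⟩ := H v hv
  refine ⟨ρ₀, hρ₀, fun ρ h0 h1 => ?_⟩
  obtain ⟨c, φ, Θ, hc, hφ, hΘ, h⟩ := hρ ρ h0 h1
  exact SoloInformed.hasGroundStateBEC_of_pairing v ρ hc φ hφ Θ hΘ h

end Summit.AtomisticToContinuum.BoseEinsteinCondensation.Theorems
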